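import Literature.Topology.FourManifolds.MMSWStripTwist
import Literature.Topology.FourManifolds.MMSWPictureGeneralPosition
import HarnessLib

/-!
# `MMSW.eventually_approxHasRasmussen`: reduction to the stability of strip-twisted pictures

Staging file (playbook pattern `X_of (inputs)`) for the named fact
`Literature.Topology.FourManifolds.MMSW.eventually_approxHasRasmussen` of
`MMSWRasmussenFacts.lean` — Manolescu–Marengon–Sarkar–Willis, Duke Math. J. 172 (2023),
arXiv:1910.08195, Thm. 1.4 / Prop. 8.2 (i): for a null-homologous model knot `K ⊂ M_r` missing
the cores, the Rasmussen invariants of the finite approximations `D(k⃗)(K)` are eventually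
constant.  The fact is NOT discharged here.  What the tree has (all proved):

* the case `r = 0` outright (`exists_forall_approxHasRasmussen_zero_left`);
* `s(D(k⃗ + j⃗)(K)) = s(D(j⃗)(stripTwist r k w ∘ K))` for every `k` and band half-width `0 < w < 1`
  (`approxHasRasmussen_iff_stripTwist`, `MMSWStripTwist.lean`: the spread-out twist `σ^k` is
  isotopic through model knots to `k` full twists concentrated in thin bands above the holes; the
  same holds for offset bands, `approxHasRasmussen_iff_stripTwistAt`);
* general position of the picture up to core-missing model isotopy, preserving every
  `ApproxHasRasmussen r k` (`IsModelKnot.exists_isSmoothModelIsotopy_inGeneralPosition`,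
  `MMSWPictureGeneralPosition.lean`) and null-homology (`IsSmoothModelIsotopy.isNullHomologous`).

Hence the fact follows from — indeed, given the second point, is equivalent to — **strip
stability**: for `r ≥ 1` and a core-missing null-homologous model knot `K` (which may be taken
with picture `D(0⃗)(K)` a knot of the tree in general position), the Rasmussen invariants of the
UNTWISTED pictures `D(0⃗)` of the strip-twisted knots `stripTwist r k w ∘ K` are constant for all
large `k`, for SOME band width (centred bands suffice for the reduction; the offset freedom of
`stripTwistAt` is for the read-off).  That input is MMSW's finite approximation theorem proper (Thm. 3.3: `s(D) = s(D(k⃗))`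
for `k ≥ ⌈(n⁺_D + 2)/2⌉`, via Willis's stabilisation of the Khovanov complexes of `D(k⃗)`,
Cor. 2.2, and the survival of the Lee generators, Thm. 2.10) read in the model: the pictures of the
strip-twisted knots are the diagrams `D(k⃗)` for the spanning discs of the dotted circles seen
edge-on (header of `MMSWStripTwist.lean`).  It is recorded below as the HYPOTHESIS of the two
reduction theorems, not as a named fact.

## References

* C. Manolescu, M. Marengon, S. Sarkar, M. Willis, Duke Math. J. 172 (2023) 231–311,
  arXiv:1910.08195, Thm. 1.4, Cor. 2.2, Thm. 2.10, Thm. 3.3, Prop. 8.2, §8.1.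
  [ManolescuMarengonSarkarWillis2023]
* M. Willis, *Khovanov homology for links in `#ʳ(S² × S¹)`*, Michigan Math. J. 70 (2021),
  arXiv:1812.06584, Thm. 1.1. [folklore]
-/

open scoped Manifold ContDiff Topology
open Function Set

noncomputable section

namespace Literature.Topology.FourManifolds

/-- Local notation: `𝔼 n` is the model Euclidean space `EuclideanSpace ℝ (Fin n)`. -/
local notation "𝔼 " n:arg => EuclideanSpace ℝ (Fin n)

/-- Local notation: `𝕊 n` is the unit sphere in `EuclideanSpace ℝ (Fin (n + 1))`. -/
local notation "𝕊 " n:arg => (Metric.sphere (0 : EuclideanSpace ℝ (Fin (n + 1))) 1)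

namespace MMSW

open Literature.AlgebraicTopology.Homotopy.HopfFibration (wC)

/-- **Reduction of `eventually_approxHasRasmussen` to strip stability.**  If for every `r ≥ 1`
and every core-missing null-homologous model knot `K ⊂ M_r` there is a band half-width `0 < w < 1`
for which the Rasmussen invariants of the untwisted pictures of the strip-twisted knots
`stripTwist r k w ∘ K` are constant for all large `k` (MMSW Thm. 3.3 read in the model — the
input, hypothesis `h`), then the named fact `MMSW.eventually_approxHasRasmussen` holds: for
`r = 0` it is proved outright, and for `r ≥ 1` `s(D(k⃗)(K)) = s(D(0⃗)(stripTwist_k ∘ K))`.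
[cite: ManolescuMarengonSarkarWillis2023, Thm. 3.3 and Prop. 8.2 (i)] -/
theorem eventually_approxHasRasmussen_of_stripStable
    (h : ∀ {r : ℕ} {K : 𝕊 1 → 𝔼 4}, 0 < r → IsModelKnot r K → IsNullHomologous r K →
      (∀ t, wC (K t) ≠ 0) →
        ∃ (w : ℝ) (s k₀ : ℤ), 0 < w ∧ w < 1 ∧
          ∀ k, k₀ ≤ k → ApproxHasRasmussen r 0 (stripTwist r k w ∘ K) s) :
    eventually_approxHasRasmussen := by
  intro r K hK h0 hw
  rcases Nat.eq_zero_or_pos r with rfl | hr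
  · exact exists_forall_approxHasRasmussen_zero_left hK hw
  · obtain ⟨w, s, k₀, hw0, hw1, hk⟩ := h hr hK h0 hw
    refine ⟨s, k₀, fun k hkk ↦ ?_⟩
    have h' := hk k hkk
    rwa [← approxHasRasmussen_iff_stripTwist hK hw k hw0 hw1 0 s, add_zero] at h'

/-- **The same reduction with the input required only in general position**: it suffices to
know strip stability for core-missing null-homologous model knots `K` whose standard picture
`D(0⃗)(K)` is a knot of the tree in general position with respect to the stereographic projection
(`Knot.InGeneralPosition`, so that its Gauss diagram is read off from its own double points) —
every core-missing model knot is smoothly model-isotopic through core-missing knots to such a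
`K`, with the same null-homology and the same Rasmussen invariants of all finite approximations
(`IsModelKnot.exists_isSmoothModelIsotopy_inGeneralPosition`).
[cite: ManolescuMarengonSarkarWillis2023, Thm. 3.3, Prop. 8.2 (i) and §8.1] -/
theorem eventually_approxHasRasmussen_of_stripStable_inGeneralPosition
    (h : ∀ {r : ℕ} {K : 𝕊 1 → 𝔼 4}, 0 < r → IsModelKnot r K → IsNullHomologous r K →
      (∀ t, wC (K t) ≠ 0) → (∃ K₃ : Knot, ⇑K₃ = finiteApprox r 0 K ∧ K₃.InGeneralPosition) →
        ∃ (w : ℝ) (s k₀ : ℤ), 0 < w ∧ w < 1 ∧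
          ∀ k, k₀ ≤ k → ApproxHasRasmussen r 0 (stripTwist r k w ∘ K) s) :
    eventually_approxHasRasmussen := by
  refine eventually_approxHasRasmussen_of_stripStable fun {r} {K} hr hK h0 hw ↦ ?_
  obtain ⟨K', hiso, hK', hw', hiff, K₃', hK₃', hgp⟩ :=
    hK.exists_isSmoothModelIsotopy_inGeneralPosition hw
  obtain ⟨w, s, k₀, hw0, hw1, hk⟩ := h hr hK' (hiso.isNullHomologous h0) hw' ⟨K₃', hK₃', hgp⟩
  refine ⟨w, s, k₀, hw0, hw1, fun k hkk ↦ ?_⟩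
  -- transport along the isotopy: `D(k⃗)(K) ~ D(k⃗)(K')`, and strip pictures on both sides
  have h1 := hk k hkk
  rw [← approxHasRasmussen_iff_stripTwist hK' hw' k hw0 hw1 0 s, add_zero] at h1
  rw [← approxHasRasmussen_iff_stripTwist hK hw k hw0 hw1 0 s, add_zero]
  exact (hiff k s).2 h1


/-! ## The same reductions with offset bands -/

/-- **Reduction to strip stability for offset bands** (`stripTwistAt`, offsets `|e_j| + w < 1`):
a weaker input than `eventually_approxHasRasmussen_of_stripStable` (the bands may be chosen per
knot, e.g. generic as in `MMSWBandGenericity`). [cite: ManolescuMarengonSarkarWillis2023, Thm. 3.3 and Prop. 8.2 (i)] -/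
theorem eventually_approxHasRasmussen_of_stripStableAt
    (h : ∀ {r : ℕ} {K : 𝕊 1 → 𝔼 4}, 0 < r → IsModelKnot r K → IsNullHomologous r K →
      (∀ t, wC (K t) ≠ 0) →
        ∃ (w : ℝ) (e : Fin r → ℝ) (s k₀ : ℤ), 0 < w ∧ (∀ j, |e j| + w < 1) ∧
          ∀ k, k₀ ≤ k → ApproxHasRasmussen r 0 (stripTwistAt r k w e ∘ K) s) :
    eventually_approxHasRasmussen := by
  intro r K hK h0 hw
  rcases Nat.eq_zero_or_pos r with rfl | hr
  · exact exists_forall_approxHasRasmussen_zero_left hK hw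
  · obtain ⟨w, e, s, k₀, hw0, he, hk⟩ := h hr hK h0 hw
    refine ⟨s, k₀, fun k hkk ↦ ?_⟩
    have h' := hk k hkk
    rwa [← approxHasRasmussen_iff_stripTwistAt hK hw k hw0 he 0 s, add_zero] at h'

/-- **Reduction to strip stability for offset bands, input in general position only.**
[cite: ManolescuMarengonSarkarWillis2023, Thm. 3.3, Prop. 8.2 (i) and §8.1] -/
theorem eventually_approxHasRasmussen_of_stripStableAt_inGeneralPosition
    (h : ∀ {r : ℕ} {K : 𝕊 1 → 𝔼 4}, 0 < r → IsModelKnot r K → IsNullHomologous r K →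
      (∀ t, wC (K t) ≠ 0) → (∃ K₃ : Knot, ⇑K₃ = finiteApprox r 0 K ∧ K₃.InGeneralPosition) →
        ∃ (w : ℝ) (e : Fin r → ℝ) (s k₀ : ℤ), 0 < w ∧ (∀ j, |e j| + w < 1) ∧
          ∀ k, k₀ ≤ k → ApproxHasRasmussen r 0 (stripTwistAt r k w e ∘ K) s) :
    eventually_approxHasRasmussen := by
  refine eventually_approxHasRasmussen_of_stripStableAt fun {r} {K} hr hK h0 hw ↦ ?_
  obtain ⟨K', hiso, hK', hw', hiff, K₃', hK₃', hgp⟩ :=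
    hK.exists_isSmoothModelIsotopy_inGeneralPosition hw
  obtain ⟨w, e, s, k₀, hw0, he, hk⟩ := h hr hK' (hiso.isNullHomologous h0) hw' ⟨K₃', hK₃', hgp⟩
  refine ⟨w, e, s, k₀, hw0, he, fun k hkk ↦ ?_⟩
  have h1 := hk k hkk
  rw [← approxHasRasmussen_iff_stripTwistAt hK' hw' k hw0 he 0 s, add_zero] at h1
  rw [← approxHasRasmussen_iff_stripTwistAt hK hw k hw0 he 0 s, add_zero]
  exact (hiff k s).2 h1

end MMSW

end Literature.Topology.FourManifolds

end
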